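import Literature.AlgebraicGeometry.Frobenioids.Thm36SubPerfectionUnitsQ
import Literature.AlgebraicGeometry.Frobenioids.PerfectionGroupification
import HarnessLib

/-!
# Frobenioids II, Thm. 3.6 (i)/(v) for `C^ℚ := C^pf`: the unit group `O^×((A, n))` of THE perfection IS the
# perfection `(O_K^×)^pf` of the angular units `Φ^∡(K) = O_K^×` — the `Φ^∡`-factor of "rational function
# monoid ≅ (Φ^fld)^ℚ" (M13-c3 FILE B-arch, part 1)

Mochizuki, *The geometry of Frobenioids II: poly-Frobenioids*, Kyushu J. Math. **62** (2008) 401–460, §3,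
Theorem 3.6, kurims text p. 36 (preamble: "`Φ^∡ … Spec(K) ↦ O_K^×`", "`Φ^fld := Φ^gp × Φ^∡`",
"`(Φ^fld)^ℚ := (Φ^fld)^pf`"), (i) l. 35 ("rational function monoid naturally isomorphic to `(Φ^fld)^Λ`") and
(v) p. 37 ("`O^×(A)` … [and in fact isomorphic to `S¹ ⊗_ℤ ℚ`] if and only if `Λ = ℚ` and `A` is complex")
[cite: MochizukiFrdII2008, Thm 3.6 (i) p.36].

abc-iut cell, layer L1, row M13-c3 «FILE B-arch» (HOME/staging/L1/L1-t6/g3/M13-c3-DESIGN.md, SHAPES 06:1xZ;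
seat abc-iut-L1-t6).  For `X = (A, n)` an object of THE perfection `C^pf` (`Thm36Sub.pfCat π hF`) of the
archimedean Frobenioid over `π : D → D₀`, with base field `K = π(A_D)`:
* `isPerfect_mulTensorRat` — `S¹ ⊗_ℤ ℚ` (any `M ⊗_ℤ ℚ`) is uniquely divisible;
* `unitValHom X : O^×(X) →* (S¹ ⊗_ℤ ℚ)` — abc-iut-w5-d237/w4-d074's value map `unitVal` bundled; injective
  (`unitVal_injective`), so `O^×(X)` is commutative and TORSION-FREE and, for `A` complex, uniquely divisible
  (`pow_bijective_unitsSubgroup`);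
* `perfUnitVal K : (O_K^×)^pf →* (S¹ ⊗_ℤ ℚ)`, `[w]^{1/c} ↦ w ⊗ 1/c` (`Perfection.extend` into the perfect
  target), injective (`perfUnitVal_injective`), surjective for `K` complex;
* **`unitsPerfEquiv X : Perfection (O_K^×) ≃* O^×(X)`** — for `A` complex the composite of the two
  bijections onto `S¹ ⊗_ℤ ℚ`, for `A` real the isomorphism of trivial groups (`(±1)^pf = 1`,
  `O^×(X) = 1` by `eq_one_of_isReal`); characterised uniformly by
  `unitVal X (unitsPerfEquiv X [w]^{1/c}) = w ⊗ 1/c` (`unitVal_unitsPerfEquiv_mk`).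
This is the `Φ^∡`-coordinate of the identification `(Φ^fld)^pf(A_D) ≅ O^×(X^birat)` (the `Φ^gp`-coordinate
is the radial section of FILE A, seat abc-iut-w5-d246).  Data-level `noncomputable def`s (homomorphisms /
equivalences), no `def … : Prop`, no instances; [FrdII] §3 is classical; nothing here bears on [IUTchIII] Cor. 3.12.
-/

noncomputable section

namespace Literature.AlgebraicGeometry.Frobenioids

open CategoryTheory Opposite Literature.AnabelianGeometry.EtaleTheta
open scoped TensorProduct

namespace ArchFrd

namespace Thm36Sub

/-! ### `M ⊗_ℤ ℚ` is uniquely divisible -/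

section TensorRat

variable {M : Type*} [AddCommGroup M]

/-- `M ⊗_ℤ ℚ` is torsion-free: `n • t = 0`, `n ≥ 1` ⇒ `t = 0` (transport to the `ℚ`-vector space
`ℚ ⊗_ℤ M`). [cite: MochizukiFrdII2008, Thm 3.6 (v) p.37] -/
theorem tensorRat_eq_zero_of_nsmul_eq_zero {n : ℕ} (hn : 0 < n) (t : M ⊗[ℤ] ℚ) (h : n • t = 0) : t = 0 := by
  have hn' : (n : ℚ) ≠ 0 := by exact_mod_cast hn.ne'
  have h1 : n • (TensorProduct.comm ℤ M ℚ t) = 0 := by rw [← map_nsmul, h, map_zero]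
  have h2 : (TensorProduct.comm ℤ M ℚ t) = 0 := by
    rw [← Nat.cast_smul_eq_nsmul ℚ n] at h1
    rw [← inv_smul_smul₀ hn' (TensorProduct.comm ℤ M ℚ t), h1, smul_zero]
  have := congrArg (TensorProduct.comm ℤ M ℚ).symm h2
  rwa [LinearEquiv.symm_apply_apply, map_zero] at this

/-- `n • (−)` is injective on `M ⊗_ℤ ℚ` for `n ≥ 1`. [cite: MochizukiFrdII2008, Thm 3.6 (v) p.37] -/
theorem tensorRat_nsmul_injective {n : ℕ} (hn : 0 < n) : Function.Injective fun t : M ⊗[ℤ] ℚ => n • t := by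
  intro t t' h
  have h' : n • (t - t') = 0 := by
    have := h
    dsimp only at this
    rw [smul_sub, this, sub_self]
  exact sub_eq_zero.mp (tensorRat_eq_zero_of_nsmul_eq_zero hn _ h')

/-- `M ⊗_ℤ ℚ` is divisible: every `t` is `n • s`. [cite: MochizukiFrdII2008, Thm 3.6 (v) p.37] -/
theorem tensorRat_exists_nsmul_eq {n : ℕ} (hn : 0 < n) (t : M ⊗[ℤ] ℚ) : ∃ s : M ⊗[ℤ] ℚ, n • s = t := by
  have hn' : (n : ℚ) ≠ 0 := by exact_mod_cast hn.ne'
  induction t using TensorProduct.induction_on with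
  | zero => exact ⟨0, smul_zero _⟩
  | tmul y q =>
    refine ⟨y ⊗ₜ[ℤ] (q / n), ?_⟩
    rw [TensorProduct.smul_tmul', ← natCast_zsmul, zsmul_tmul_eq, Int.cast_natCast, mul_div_cancel₀ _ hn']
  | add s t hs ht =>
    obtain ⟨a, ha⟩ := hs
    obtain ⟨b, hb⟩ := ht
    exact ⟨a + b, by rw [smul_add, ha, hb]⟩

/-- `M ⊗_ℤ ℚ`, written multiplicatively, is a perfect monoid ([FrdI] §0: every `n`-th power map bijective).
[cite: MochizukiFrdI2008, §0 p.11] -/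
theorem isPerfect_mulTensorRat : IsPerfect (Multiplicative (M ⊗[ℤ] ℚ)) := by
  refine ⟨fun n hn => ⟨fun a b h => ?_, fun a => ?_⟩⟩
  · have h' : n • Multiplicative.toAdd a = n • Multiplicative.toAdd b := by
      rw [← toAdd_pow, ← toAdd_pow]; exact congrArg _ h
    exact Multiplicative.toAdd.injective (tensorRat_nsmul_injective hn h')
  · obtain ⟨s, hs⟩ := tensorRat_exists_nsmul_eq hn (Multiplicative.toAdd a)
    exact ⟨Multiplicative.ofAdd s, by
      change Multiplicative.ofAdd s ^ n = a
      rw [← ofAdd_nsmul, hs, ofAdd_toAdd]⟩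

/-- `c • (x ⊗ 1/c) = x ⊗ 1`. [cite: MochizukiFrdII2008, Thm 3.6 (v) p.37] -/
theorem nsmul_tmul_inv (x : M) (c : ℕ+) :
    (c : ℕ) • (x ⊗ₜ[ℤ] ((c : ℚ)⁻¹) : M ⊗[ℤ] ℚ) = x ⊗ₜ[ℤ] 1 := by
  have hc : ((c : ℕ) : ℚ) ≠ 0 := by exact_mod_cast c.ne_zero
  rw [TensorProduct.smul_tmul', ← natCast_zsmul, zsmul_tmul_eq, Int.cast_natCast, mul_inv_cancel₀ hc]

end TensorRat

/-! ### `(O_K^×)^pf → S¹ ⊗_ℤ ℚ` -/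

section UnitScalars

variable (K : D0)

/-- `O_K^× → S¹ ⊗_ℤ ℚ`, `w ↦ w ⊗ 1` (multiplicative notation on the target). [cite: MochizukiFrdII2008, Thm 3.6 (v) p.37] -/
def unitScalarVal : D0.unitScalars K →* Multiplicative (Additive Circle ⊗[ℤ] ℚ) where
  toFun w := Multiplicative.ofAdd (Additive.ofMul (unitCirc (w : ℂˣ)) ⊗ₜ[ℤ] (1 : ℚ))
  map_one' := by
    change Multiplicative.ofAdd (Additive.ofMul (unitCirc ((1 : D0.unitScalars K) : ℂˣ)) ⊗ₜ[ℤ] (1 : ℚ)) = 1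
    rw [OneMemClass.coe_one, unitCirc_one, ofMul_one, TensorProduct.zero_tmul, ofAdd_zero]
  map_mul' a b := by
    change Multiplicative.ofAdd (Additive.ofMul (unitCirc ((a * b : D0.unitScalars K) : ℂˣ)) ⊗ₜ[ℤ] (1 : ℚ)) = _
    rw [Subgroup.coe_mul, unitCirc_mul a.2.2 b.2.2, ofMul_mul, TensorProduct.add_tmul, ofAdd_add]

/-- Unfolding `unitScalarVal`. [cite: MochizukiFrdII2008, Thm 3.6 (v) p.37] -/
theorem unitScalarVal_apply (w : D0.unitScalars K) :
    unitScalarVal K w = Multiplicative.ofAdd (Additive.ofMul (unitCirc (w : ℂˣ)) ⊗ₜ[ℤ] (1 : ℚ)) := rfl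

/-- **`(O_K^×)^pf → S¹ ⊗_ℤ ℚ`**, the extension of `w ↦ w ⊗ 1` to the perfection (the target is perfect).
[cite: MochizukiFrdII2008, Thm 3.6 (v) p.37] -/
def perfUnitVal : Perfection (D0.unitScalars K) →* Multiplicative (Additive Circle ⊗[ℤ] ℚ) :=
  Perfection.extend isPerfect_mulTensorRat (unitScalarVal K)

/-- `perfUnitVal [w]^{1/c} = w ⊗ (1/c)`: the `c`-th root of `w ⊗ 1`. [cite: MochizukiFrdII2008, Thm 3.6 (v) p.37] -/
theorem perfUnitVal_mk (w : D0.unitScalars K) (c : ℕ+) :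
    perfUnitVal K (Perfection.mk w c) =
      Multiplicative.ofAdd (Additive.ofMul (unitCirc (w : ℂˣ)) ⊗ₜ[ℤ] ((c : ℚ)⁻¹)) := by
  apply (isPerfect_mulTensorRat.bijective_pow (c : ℕ) c.pos).1
  dsimp only
  rw [← map_pow, Perfection.mk_pow_self, perfUnitVal, Perfection.extend_of, unitScalarVal_apply,
    ← ofAdd_nsmul, nsmul_tmul_inv]

/-- Every element of `(O_K^×)^pf` is invertible (`O_K^×` is a group). [cite: MochizukiFrdI2008, §0 p.11] -/
theorem isUnit_perfection_unitScalars (x : Perfection (D0.unitScalars K)) : IsUnit x := by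
  obtain ⟨⟨w, c⟩, rfl⟩ := Perfection.mk_surjective x
  change IsUnit (Perfection.mk w c)
  rw [← isUnit_pow_iff (PNat.ne_zero c), Perfection.mk_pow_self]
  exact (Group.isUnit w).map (Perfection.of _)

/-- `perfUnitVal` has trivial kernel: `w ⊗ 1/c = 0` forces `w` torsion, and torsion dies in the perfection.
[cite: MochizukiFrdII2008, Thm 3.6 (v) p.37] -/
theorem perfUnitVal_eq_one_imp {x : Perfection (D0.unitScalars K)} (h : perfUnitVal K x = 1) : x = 1 := by
  obtain ⟨⟨w, c⟩, rfl⟩ := Perfection.mk_surjective x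
  change perfUnitVal K (Perfection.mk w c) = 1 at h
  change Perfection.mk w c = 1
  rw [perfUnitVal_mk] at h
  have h0 : (Additive.ofMul (unitCirc (w : ℂˣ)) ⊗ₜ[ℤ] ((c : ℚ)⁻¹) : Additive Circle ⊗[ℤ] ℚ) = 0 :=
    Multiplicative.ofAdd.injective h
  obtain ⟨N, hN⟩ := exists_pnat_smul_eq_zero_of_tmul_eq_zero _ (inv_ne_zero (by exact_mod_cast c.ne_zero)) h0
  rw [natCast_zsmul, ← ofMul_pow, ofMul_eq_zero, ← unitCirc_pow w.2.2, unitCirc_eq_one_iff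
    (by rw [Units.val_pow_eq_pow_val, norm_pow, w.2.2, one_pow])] at hN
  exact Perfection.mk_eq_one_iff.mpr ⟨N, Subtype.ext (by rw [SubmonoidClass.coe_pow]; exact hN)⟩

/-- `perfUnitVal` is injective. [cite: MochizukiFrdII2008, Thm 3.6 (v) p.37] -/
theorem perfUnitVal_injective : Function.Injective (perfUnitVal K) := by
  intro x y h
  obtain ⟨u, rfl⟩ := isUnit_perfection_unitScalars K y
  have h1 : perfUnitVal K (x * ↑u⁻¹) = 1 := by
    rw [map_mul, h, ← map_mul, Units.mul_inv, map_one]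
  have h2 := perfUnitVal_eq_one_imp K h1
  calc x = x * ↑u⁻¹ * ↑u := by rw [Units.inv_mul_cancel_right]
    _ = ↑u := by rw [h2, one_mul]

/-- For `K = Spec ℂ`, `perfUnitVal` is surjective: `y ⊗ (a/b)` is the value of `[y^a]^{1/b}`.
[cite: MochizukiFrdII2008, Thm 3.6 (v) p.37] -/
theorem perfUnitVal_surjective_of_isComplex (hK : K.IsComplex) : Function.Surjective (perfUnitVal K) := by
  have hK' : K = .complex := hK
  subst hK'
  intro t
  induction h : Multiplicative.toAdd t using TensorProduct.induction_on generalizing t with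
  | zero =>
    refine ⟨1, ?_⟩
    rw [map_one, ← ofAdd_toAdd t, h, ofAdd_zero]
  | tmul y q =>
    -- `t = y ⊗ q`, `q = num/den`: the class `[y^num]^{1/den}`
    let w : D0.unitScalars D0.complex :=
      ⟨Circle.toUnits ((Additive.toMul y) ^ q.num), by
        exact ⟨by simp [D0.scalars_complex], norm_coe_circle_toUnits _⟩⟩
    refine ⟨Perfection.mk w ⟨q.den, q.den_pos⟩, ?_⟩
    rw [perfUnitVal_mk, ← ofAdd_toAdd t, h]
    congr 1
    change Additive.ofMul (unitCirc (Circle.toUnits ((Additive.toMul y) ^ q.num))) ⊗ₜ[ℤ] (((q.den : ℕ) : ℚ)⁻¹) = _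
    rw [unitCirc_toUnits, ofMul_zpow, ofMul_toMul, zsmul_tmul_eq, ← div_eq_mul_inv, Rat.num_div_den]
  | add a b ha hb =>
    obtain ⟨x, hx⟩ := ha (Multiplicative.ofAdd a) (toAdd_ofAdd _)
    obtain ⟨y, hy⟩ := hb (Multiplicative.ofAdd b) (toAdd_ofAdd _)
    refine ⟨x * y, ?_⟩
    rw [map_mul, hx, hy, ← ofAdd_add, ← h, ofAdd_toAdd]

/-- For `K = Spec ℝ` the perfection `(O_ℝ^×)^pf = (±1)^pf` is trivial (`(±1)² = 1`).
[cite: MochizukiFrdII2008, Thm 3.6 (v) p.37] -/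
theorem perfection_unitScalars_eq_one_of_isReal (hK : K.IsReal) (x : Perfection (D0.unitScalars K)) :
    x = 1 := by
  have hK' : K = .real := hK
  subst hK'
  obtain ⟨⟨w, c⟩, rfl⟩ := Perfection.mk_surjective x
  change Perfection.mk w c = 1
  have hsq : (w : ℂˣ) ^ ((2 : ℕ+) : ℕ) = 1 := by
    rcases UnitStab.eq_one_or_eq_neg_one_of_mem_scalars_real w.2.1 w.2.2 with h | h
    · rw [h, one_pow]
    · rw [h]; exact neg_one_sq
  exact Perfection.mk_eq_one_iff.mpr ⟨2, Subtype.ext (by rw [SubmonoidClass.coe_pow]; exact hsq)⟩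

end UnitScalars

/-! ### `O^×((A, n)) → S¹ ⊗_ℤ ℚ` as a homomorphism; injectivity; the equivalence with `(O_K^×)^pf` -/

section Units

universe v u

variable {D : Type u} [Category.{v} D] {π : D ⥤ D0}
variable {hF : PreFrobenioid.IsFrobenioid (C.toElem π)} (X : pfCat π hF)

open PreFrobenioid PreFrobenioid.Perfection

/-- A torsion element tensor anything vanishes in `M ⊗_ℤ ℚ`. [cite: MochizukiFrdII2008, Thm 3.6 (v) p.37] -/
theorem tmul_eq_zero_of_nsmul_eq_zero {M : Type*} [AddCommGroup M] {x : M} {n : ℕ} (hn : 0 < n)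
    (hx : n • x = 0) (q : ℚ) : (x ⊗ₜ[ℤ] q : M ⊗[ℤ] ℚ) = 0 := by
  have hn' : (n : ℚ) ≠ 0 := by exact_mod_cast hn.ne'
  calc (x ⊗ₜ[ℤ] q : M ⊗[ℤ] ℚ) = x ⊗ₜ[ℤ] ((n : ℤ) * (q / n)) := by
        rw [Int.cast_natCast, mul_div_cancel₀ _ hn']
    _ = ((n : ℤ) • x) ⊗ₜ[ℤ] (q / n) := (zsmul_tmul_eq x n (q / n)).symm
    _ = 0 := by rw [natCast_zsmul, hx, TensorProduct.zero_tmul]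

/-- **The value map `O^×((A, n)) → S¹ ⊗_ℤ ℚ` as a homomorphism** (abc-iut-w5-d237's `unitVal`, bundled;
multiplicative notation on the target). [cite: MochizukiFrdII2008, Thm 3.6 (v) p.37] -/
def unitValHom : unitsSubgroup (pfStr π hF) X →* Multiplicative (Additive Circle ⊗[ℤ] ℚ) where
  toFun u := Multiplicative.ofAdd (unitVal X u)
  map_one' := by rw [unitVal_one, ofAdd_zero]
  map_mul' u v := by rw [unitVal_mul, ofAdd_add]

/-- Unfolding `unitValHom`. [cite: MochizukiFrdII2008, Thm 3.6 (v) p.37] -/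
theorem unitValHom_apply (u : unitsSubgroup (pfStr π hF) X) :
    unitValHom X u = Multiplicative.ofAdd (unitVal X u) := rfl

/-- `unitVal` is injective (its kernel is trivial, `eq_one_of_unitVal_eq_zero`). [cite: MochizukiFrdII2008, Thm 3.6 (v) p.37] -/
theorem unitValHom_injective : Function.Injective (unitValHom X) :=
  (injective_iff_map_eq_one (unitValHom X)).mpr fun u hu =>
    eq_one_of_unitVal_eq_zero X u (Multiplicative.ofAdd.injective (by rw [← unitValHom_apply, hu, ofAdd_zero]))

/-- `unitVal` is injective. [cite: MochizukiFrdII2008, Thm 3.6 (v) p.37] -/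
theorem unitVal_injective : Function.Injective (unitVal X) := fun u v h =>
  unitValHom_injective X (by rw [unitValHom_apply, unitValHom_apply, h])

/-- `O^×((A, n))` is commutative ([FrdI] Rem. 1.3.1; here: it embeds in `S¹ ⊗_ℤ ℚ`).
[cite: MochizukiFrdI2008, Rem. 1.3.1 p.25] -/
theorem unitsSubgroup_mul_comm (u v : unitsSubgroup (pfStr π hF) X) : u * v = v * u :=
  unitValHom_injective X (by rw [map_mul, map_mul, mul_comm])

/-- For `A` complex, `O^×((A, n)) → S¹ ⊗_ℤ ℚ` is bijective ("`O^×(A) ≅ S¹ ⊗_ℤ ℚ`", Thm. 3.6 (v)).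
[cite: MochizukiFrdII2008, Thm 3.6 (v) p.37] -/
theorem unitValHom_bijective_of_isComplex (hX : (π.obj X.obj.snd).IsComplex) :
    Function.Bijective (unitValHom X) :=
  ⟨unitValHom_injective X, fun t => by
    obtain ⟨u, hu⟩ := unitVal_surjective X hX (Multiplicative.toAdd t)
    exact ⟨u, by rw [unitValHom_apply, hu, ofAdd_toAdd]⟩⟩

/-- **`(O_K^×)^pf ≃ O^×((A, n))` for `A` complex**: both are `S¹ ⊗_ℤ ℚ` (`perfUnitVal`, `unitValHom`).
[cite: MochizukiFrdII2008, Thm 3.6 (v) p.37] -/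
def unitsPerfEquivOfComplex (hX : (π.obj X.obj.snd).IsComplex) :
    Perfection (D0.unitScalars (π.obj X.obj.snd)) ≃* unitsSubgroup (pfStr π hF) X :=
  (MulEquiv.ofBijective (perfUnitVal (π.obj X.obj.snd))
      ⟨perfUnitVal_injective _, perfUnitVal_surjective_of_isComplex _ hX⟩).trans
    (MulEquiv.ofBijective (unitValHom X) (unitValHom_bijective_of_isComplex X hX)).symm

/-- The complex equivalence is compatible with the two value maps. [cite: MochizukiFrdII2008, Thm 3.6 (v) p.37] -/
theorem unitValHom_unitsPerfEquivOfComplex (hX : (π.obj X.obj.snd).IsComplex)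
    (x : Perfection (D0.unitScalars (π.obj X.obj.snd))) :
    unitValHom X (unitsPerfEquivOfComplex X hX x) = perfUnitVal (π.obj X.obj.snd) x := by
  unfold unitsPerfEquivOfComplex
  rw [MulEquiv.trans_apply, ← MulEquiv.ofBijective_apply (unitValHom X) (unitValHom_bijective_of_isComplex X hX),
    MulEquiv.apply_symm_apply, MulEquiv.ofBijective_apply]

/-- **`(O_K^×)^pf ≃ O^×((A, n))` for `A` real**: both groups are trivial (`(±1)^pf = 1`;
`O^×((A, n)) = 1`, `eq_one_of_isReal`). [cite: MochizukiFrdII2008, Thm 3.6 (v) p.37] -/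
def unitsPerfEquivOfReal (hX : (π.obj X.obj.snd).IsReal) :
    Perfection (D0.unitScalars (π.obj X.obj.snd)) ≃* unitsSubgroup (pfStr π hF) X where
  toFun _ := 1
  invFun _ := 1
  left_inv x := (perfection_unitScalars_eq_one_of_isReal _ hX x).symm
  right_inv u := (Subtype.ext (eq_one_of_isReal X hX u.1 u.2) : u = 1).symm
  map_mul' _ _ := (mul_one _).symm

open Classical in
/-- **`(O_K^×)^pf ≃* O^×((A, n))`** — the `Φ^∡`-coordinate of "the rational function monoid of `C^ℚ = C^pf` is
`(Φ^fld)^ℚ = (Φ^gp × Φ^∡)^pf`" (Thm. 3.6 (i) at `Λ = ℚ`), uniformly in `A` (complex: via `S¹ ⊗_ℤ ℚ`; real: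
trivial groups). [cite: MochizukiFrdII2008, Thm 3.6 (i) p.36] -/
def unitsPerfEquiv : Perfection (D0.unitScalars (π.obj X.obj.snd)) ≃* unitsSubgroup (pfStr π hF) X :=
  if hX : (π.obj X.obj.snd).IsComplex then unitsPerfEquivOfComplex X hX
  else unitsPerfEquivOfReal X ((D0.isReal_or_isComplex _).resolve_right hX)

/-- **Characterisation of `unitsPerfEquiv`**: the unit `unitsPerfEquiv X [w]^{1/c}` has value `w ⊗ (1/c)`
in `S¹ ⊗_ℤ ℚ` — uniformly in `A` (for `A` real both sides vanish: `w = ±1` is torsion).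
[cite: MochizukiFrdII2008, Thm 3.6 (v) p.37] -/
theorem unitVal_unitsPerfEquiv_mk (w : D0.unitScalars (π.obj X.obj.snd)) (c : ℕ+) :
    unitVal X (unitsPerfEquiv X (Perfection.mk w c)) = Additive.ofMul (unitCirc (w : ℂˣ)) ⊗ₜ[ℤ] ((c : ℚ)⁻¹) := by
  classical
  unfold unitsPerfEquiv
  by_cases hX : (π.obj X.obj.snd).IsComplex
  · rw [dif_pos hX]
    apply Multiplicative.ofAdd.injective
    rw [← unitValHom_apply, unitValHom_unitsPerfEquivOfComplex, perfUnitVal_mk]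
  · rw [dif_neg hX]
    have hR : (π.obj X.obj.snd).IsReal := (D0.isReal_or_isComplex _).resolve_right hX
    have hR' : π.obj X.obj.snd = .real := hR
    change unitVal X 1 = _
    rw [unitVal_one]
    -- `w = ±1`, so `unitCirc w` is `2`-torsion and `w ⊗ 1/c = 0`
    have hw2 : (w : ℂˣ) ^ 2 = 1 := by
      rcases UnitStab.eq_one_or_eq_neg_one_of_mem_scalars_real (hR' ▸ w.2.1) w.2.2 with h | h
      · rw [h, one_pow]
      · rw [h]; exact neg_one_sq
    have htor : 2 • Additive.ofMul (unitCirc (w : ℂˣ)) = 0 := by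
      rw [← ofMul_pow, ← unitCirc_pow w.2.2, hw2, unitCirc_one, ofMul_one]
    exact (tmul_eq_zero_of_nsmul_eq_zero two_pos htor _).symm

/-- The value, as an element of `Multiplicative (S¹ ⊗_ℤ ℚ)`: `unitValHom ∘ unitsPerfEquiv = perfUnitVal`
(uniformly in `A`). [cite: MochizukiFrdII2008, Thm 3.6 (v) p.37] -/
theorem unitValHom_unitsPerfEquiv (x : Perfection (D0.unitScalars (π.obj X.obj.snd))) :
    unitValHom X (unitsPerfEquiv X x) = perfUnitVal (π.obj X.obj.snd) x := by
  obtain ⟨⟨w, c⟩, rfl⟩ := Perfection.mk_surjective x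
  change unitValHom X (unitsPerfEquiv X (Perfection.mk w c)) = perfUnitVal _ (Perfection.mk w c)
  rw [unitValHom_apply, unitVal_unitsPerfEquiv_mk, perfUnitVal_mk]

end Units

end Thm36Sub

end ArchFrd

end Literature.AlgebraicGeometry.Frobenioids

end
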